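import Mathlib.AlgebraicGeometry.EllipticCurve.Affine.Point
import HarnessLib

/-!
# Three collinear points on a Weierstrass cubic sum to zero, and conversely
# (generic lemmas for the cell `b2b-bsdres` discharge of Fisher 2012 Thm. 13.2, `n = 3` — file F1 of
# seat n1011-p02 gen 7's 'T-F132-3'; Mathlib only)

HONEST FRAMING (cell `b2b-bsdres`, run/shared/lean/b2b/bsd-rank1-residual/, verbatim in every
file): the goal of the cell is to DELETE the COMBINATION-SHAPED residual classes of the
Birch–Swinnerton-Dyer formula for ALL analytic-rank `≤ 1` elliptic curves over `ℚ` — "full BSD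
formula for every rank `≤ 1` curve in class `C`" assembled STRICTLY from published theorems — so
that the rank-`≤ 1` remainder becomes exactly the CONSTRUCTION-SHAPED classes, which are TYPED
(missing-input `Prop`s), NOT attempted. This is not "finishing BSD". This file: standard-API helper
lemmas on Mathlib's affine group law (Silverman *AEC* III.2.3: "three points of a line sum to `O`"),
no definition, no named fact.

## What this file proves

For a Weierstrass curve `W` over a field `F` in affine coordinates (Mathlib `WeierstrassCurve.Affine`):

* `equation_line_iff_eval_addPolynomial` — a point `(x, ℓ(x − x₁) + y₁)` of the line through
  `(x₁, y₁)` with slope `ℓ` lies on `W` iff `x` is a root of Mathlib's `addPolynomial x₁ y₁ ℓ`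
  (the generic form of Mathlib's `equation_add_iff`).
* `neg_add_eq_some_addX_negAddY`, `collinear_negAdd` — for `x₁ ≠ x₂`, `−(P + Q)` is the affine point
  `(addX, negAddY)` and it is COLLINEAR with `P = (x₁, y₁)`, `Q = (x₂, y₂)`:
  `(x₂ − x₁)(y₃ − y₁) = (x₃ − x₁)(y₂ − y₁)`.
* **`add_eq_neg_of_collinear`** — conversely, a nonsingular point `R = (x₃, y₃)` of `W` collinear with
  `P`, `Q` (`x₁ ≠ x₂`) and with `x₃ ∉ {x₁, x₂}` IS `−(P + Q)`: `P + Q = −R` (the cubic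
  `addPolynomial` has the three roots `x₁, x₂, addX`, Mathlib `addPolynomial_slope`).
References: [SilvermanAEC2009] III.2.3 (the group law: collinear points), III.2 Group Law Algorithm 2.3.
-/

namespace WeierstrassCurve.Affine

variable {F : Type*} [Field F] (W : Affine F)

/-- **A point of the line `y = ℓ(x − x₁) + y₁` lies on `W` iff its abscissa is a root of
`addPolynomial x₁ y₁ ℓ`** (Mathlib's `equation_add_iff`, at a general abscissa).
[cite: SilvermanAEC2009, III.2.3 (Group Law Algorithm)] -/
theorem equation_line_iff_eval_addPolynomial (x₁ y₁ ℓ x : F) :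
    W.Equation x (ℓ * (x - x₁) + y₁) ↔ (W.addPolynomial x₁ y₁ ℓ).eval x = 0 := by
  have h : (W.addPolynomial x₁ y₁ ℓ).eval x =
      (ℓ * (x - x₁) + y₁) ^ 2 + W.a₁ * x * (ℓ * (x - x₁) + y₁) + W.a₃ * (ℓ * (x - x₁) + y₁) -
        (x ^ 3 + W.a₂ * x ^ 2 + W.a₄ * x + W.a₆) := by
    simp only [addPolynomial, linePolynomial, WeierstrassCurve.Affine.polynomial, Polynomial.eval_add,
      Polynomial.eval_sub, Polynomial.eval_mul, Polynomial.eval_pow, Polynomial.eval_C,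
      Polynomial.eval_X]
    ring
  rw [WeierstrassCurve.Affine.equation_iff, h, sub_eq_zero]

variable {W}

section Points

variable [DecidableEq F]

/-- **`−(P + Q) = (addX, negAddY)`** for affine points with distinct abscissae (Mathlib
`add_of_X_ne'`). [cite: SilvermanAEC2009, III.2.3 (Group Law Algorithm)] -/
theorem neg_add_eq_some_addX_negAddY {x₁ x₂ y₁ y₂ : F} {h₁ : W.Nonsingular x₁ y₁}
    {h₂ : W.Nonsingular x₂ y₂} (hx : x₁ ≠ x₂) :
    -(Point.some x₁ y₁ h₁ + Point.some x₂ y₂ h₂) =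
      Point.some (W.addX x₁ x₂ (W.slope x₁ x₂ y₁ y₂))
        (W.negAddY x₁ x₂ y₁ (W.slope x₁ x₂ y₁ y₂))
        (nonsingular_negAdd h₁ h₂ fun hxy => hx hxy.left) := by
  rw [Point.add_of_X_ne' hx, neg_neg]

/-- `(x₂ − x₁)·slope = y₂ − y₁` for `x₁ ≠ x₂`. [folklore] -/
private theorem sub_mul_slope_of_X_ne {x₁ x₂ y₁ y₂ : F} (hx : x₁ ≠ x₂) :
    (x₂ - x₁) * W.slope x₁ x₂ y₁ y₂ = y₂ - y₁ := by
  have hx' : x₁ - x₂ ≠ 0 := sub_ne_zero.mpr hx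
  rw [slope_of_X_ne hx, mul_comm, div_mul_eq_mul_div, div_eq_iff hx']
  ring

/-- **`P`, `Q`, `−(P + Q)` are collinear** (`x₁ ≠ x₂`): with `(x₃, y₃) = (addX, negAddY)`,
`(x₂ − x₁)(y₃ − y₁) = (x₃ − x₁)(y₂ − y₁)`. [cite: SilvermanAEC2009, III.2.3 (Group Law Algorithm)] -/
theorem collinear_negAdd {x₁ x₂ y₁ y₂ : F} (hx : x₁ ≠ x₂) :
    (x₂ - x₁) * (W.negAddY x₁ x₂ y₁ (W.slope x₁ x₂ y₁ y₂) - y₁) =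
      (W.addX x₁ x₂ (W.slope x₁ x₂ y₁ y₂) - x₁) * (y₂ - y₁) := by
  have hxL := sub_mul_slope_of_X_ne (W := W) (y₁ := y₁) (y₂ := y₂) hx
  rw [negAddY]
  linear_combination (W.addX x₁ x₂ (W.slope x₁ x₂ y₁ y₂) - x₁) * hxL

/-- **A collinear on-curve point off `{P, Q}` is `−(P + Q)`.**  Let `P = (x₁, y₁)`, `Q = (x₂, y₂)` be
nonsingular points of `W` with `x₁ ≠ x₂`, and `R = (x₃, y₃)` a nonsingular point of `W` with
`x₃ ≠ x₁`, `x₃ ≠ x₂` on the line `PQ`: `(x₂ − x₁)(y₃ − y₁) = (x₃ − x₁)(y₂ − y₁)`.  Then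
`P + Q = −R` (the restriction of the Weierstrass cubic to the line has exactly the roots `x₁, x₂,
addX` — Mathlib `addPolynomial_slope`). [cite: SilvermanAEC2009, III.2.3 (Group Law Algorithm)] -/
theorem add_eq_neg_of_collinear {x₁ x₂ x₃ y₁ y₂ y₃ : F} {h₁ : W.Nonsingular x₁ y₁}
    {h₂ : W.Nonsingular x₂ y₂} {h₃ : W.Nonsingular x₃ y₃} (hx : x₁ ≠ x₂) (h31 : x₃ ≠ x₁)
    (h32 : x₃ ≠ x₂) (hcol : (x₂ - x₁) * (y₃ - y₁) = (x₃ - x₁) * (y₂ - y₁)) :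
    Point.some x₁ y₁ h₁ + Point.some x₂ y₂ h₂ = -Point.some x₃ y₃ h₃ := by
  set L := W.slope x₁ x₂ y₁ y₂ with hL
  have hx' : x₂ - x₁ ≠ 0 := sub_ne_zero.mpr (Ne.symm hx)
  -- `R` lies on the line `y = L (x − x₁) + y₁`
  have hy₃ : y₃ = L * (x₃ - x₁) + y₁ := by
    have hxL : (x₂ - x₁) * L = y₂ - y₁ := by rw [hL]; exact sub_mul_slope_of_X_ne hx
    have key : (x₂ - x₁) * (y₃ - y₁) = (x₂ - x₁) * (L * (x₃ - x₁)) := by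
      linear_combination hcol - (x₃ - x₁) * hxL
    have h := mul_left_cancel₀ hx' key
    linear_combination h
  -- hence `x₃` is a root of `addPolynomial x₁ y₁ L = -(X - x₁)(X - x₂)(X - addX)`
  have hroot : (W.addPolynomial x₁ y₁ L).eval x₃ = 0 := by
    rw [← equation_line_iff_eval_addPolynomial, ← hy₃]
    exact h₃.left
  rw [hL, addPolynomial_slope h₁.left h₂.left (fun hxy => hx hxy.left)] at hroot
  simp only [Polynomial.eval_neg, Polynomial.eval_mul, Polynomial.eval_sub, Polynomial.eval_X,
    Polynomial.eval_C, neg_eq_zero, mul_eq_zero, sub_eq_zero] at hroot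
  rcases hroot with (h | h) | h
  · exact absurd h h31
  · exact absurd h h32
  -- so `x₃ = addX` and `y₃ = negAddY`, i.e. `R = −(P + Q)`
  have hy₃' : y₃ = W.negAddY x₁ x₂ y₁ (W.slope x₁ x₂ y₁ y₂) := by
    rw [hy₃, negAddY, ← hL, h]
  rw [Point.add_of_X_ne' hx]
  congr 1
  simp only [Point.some.injEq]
  exact ⟨h.symm, hy₃'.symm⟩

end Points

end WeierstrassCurve.Affine
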